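import Summits.QuantumFields.YangMills.Theorems.BalabanUVNodesN18CombStepNearIdentity
import Summits.QuantumFields.YangMills.Theorems.UnitScaleTiltProp7LinAvgOntoBound
import HarnessLib

/-!
# N18 (β)-transport letters: the C⁰ comb letter at a near-identity factorised field — leading coefficient `Lη∕ξ`

[DAGN18W3-G4 INTENT-9, file (9b)] — count-neutral helper toward K3⁷ `stmt-QuantumFields-20544` (NOT claimed, NOT closed).  YM mass gap (Clay) NOT proved by any of
this; R4 closes the conditional finite-𝕋⁴ rung `BalabanLadder.UV` only.

(9a) `BalabanUVNodesN18CombStepNearIdentity` showed, for `S = (exp iηA)·U₀` with `|A| ≤ a`, `‖U₀ − 1‖ ≤ t` on all bonds: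
`(iξ)⁻¹ log(Ū(S)(c)Ū(U₀)(c)⁻¹) = (η∕ξ)·(Q₁A)(c) + O((ℓ²(ηa + t)² + ℓ(ηa)²)∕ξ)`.  With the tree's decomposition
`Q₁A(c) = L·(QA)(c) − (λ̄_A(c₊) − λ̄_A(c₋))` (`BlockAveragingEMLLinearised.linAvg_eq_bondAvg_sub_grad_combMean`; `Q = LatticeFieldCalculus.bondAvg`, `λ̄ = combMean`)
this file lands the C⁰ COMB LETTER in the near-identity gauge: adding the comb gradient `(η∕ξ)(λ̄_A(c₊) − λ̄_A(c₋))` (the linearised effect of the coarse gauge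
transformation generated by `l = η·λ̄_A`, [Balaban1985Averaging] (62)) leaves the straight-line mean, of norm `≤ (η∕ξ)·L·a` — coefficient `1` at `ξ = Lη` — plus
the second-order remainder; and the comb generator is small: `‖λ̄_A(y)‖ ≤ ℓ·a`.
* `norm_bondAvg_le_of_bound` (`|A| ≤ a ⇒ ‖(QA)(c)‖ ≤ a`), `norm_linAvg_add_combGrad_le` (`‖Q₁A(c) + (λ̄_A(c₊) − λ̄_A(c₋))‖ ≤ L·a`),
  ★★★ `norm_potential_add_combGrad_le` (the letter), `norm_combMean_le_of_bound` (`‖λ̄_A(y)‖ ≤ ℓ·a`, UST `Prop7LinAvgOnto.norm_combMean_le` by name).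
What is NOT here (successor, COMB-STEP-DESIGN.md): the axial-gauge reduction of run B's pair to such an `S` (locality: the hypotheses here are global in `b`), the
covariant comb `l` as a definition on run-A sites, the C¹ letter.

0 `def`, 0 `sorry`.  References: T. Bałaban, CMP **98** (1985) 17–51 [Balaban1985Averaging] ((62)–(63) p.28, (122)–(126) p.36); CMP **93** (1984) [Balaban1984PropagatorsI]
((1.11) p.19); CMP **109** (1987) [Balaban1987RG1] ((0.4) p.253, (1.13) p.262).
-/

noncomputable section

open scoped BigOperators Matrix.Norms.L2Operator
open NormedSpace

namespace YMDAG.N18.TransportOfRecord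

open Complex (I)
open Literature.MathematicalPhysics.QuantumFieldTheory.Balaban1983to89
open Literature.MathematicalPhysics.QuantumFieldTheory.Balaban1983to89.T4Continuum
open Literature.MathematicalPhysics.QuantumFieldTheory.Balaban1983to89.BlockAveraging
open Literature.MathematicalPhysics.QuantumFieldTheory.Balaban1983to89.BlockAveragingEMLLinearised (linAvg combMean linAvg_eq_bondAvg_sub_grad_combMean)
open Literature.MathematicalPhysics.QuantumFieldTheory.Balaban1983to89.LatticeFieldCalculus (bondAvg segSum runBond)
open Literature.MathematicalPhysics.QuantumFieldTheory.Balaban1983to89.B12RegularSpaces111 (expI)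
open Literature.MathematicalPhysics.QuantumFieldTheory.Balaban1983to89.MatrixLog (mlog)
open Literature.MathematicalPhysics.QuantumFieldTheory.Balaban1983to89.Node00.W1 (avgUnits)
open Summit.QuantumFields.YangMills.Theorems.Prop7LinAvgOnto (norm_combMean_le)

variable {P : Params} {j : ℕ} {n : Type*} [Fintype n] [DecidableEq n] [Nonempty n]

omit [Nonempty n] in
/-- **`|A| ≤ a ⇒ ‖(QA)(c)‖ ≤ a`**: the block average (1.11) is `L^{−(d+1)}` times a sum of `L^d` straight-contour sums of `L` terms. [cite: Balaban1984PropagatorsI, (1.11) p.19] -/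
theorem norm_bondAvg_le_of_bound (A : PBond P j → Matrix n n ℂ) {a : ℝ} (hA : ∀ b, ‖A b‖ ≤ a) (c : PBond P (j + 1)) :
    ‖bondAvg A c‖ ≤ a := by
  unfold bondAvg segSum
  have hL : (0 : ℝ) < (P.L : ℝ) := Nat.cast_pos.mpr P.L_pos
  have hL0 : (0 : ℝ) ≤ ((P.L : ℝ) ^ (P.d + 1))⁻¹ := by positivity
  rw [norm_smul, Real.norm_of_nonneg hL0]
  have hsum : ‖∑ r : Fin P.d → Fin P.L, ∑ t ∈ Finset.range P.L, A (runBond (Site.blockSite c.src r) c.dir t)‖ ≤ (P.L : ℝ) ^ (P.d + 1) * a := by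
    refine (norm_sum_le _ _).trans ?_
    have hin : ∀ r : Fin P.d → Fin P.L, ‖∑ t ∈ Finset.range P.L, A (runBond (Site.blockSite c.src r) c.dir t)‖ ≤ (P.L : ℝ) * a := fun r => by
      refine (norm_sum_le _ _).trans ?_
      have := Finset.sum_le_sum fun t (_ : t ∈ Finset.range P.L) => hA (runBond (Site.blockSite c.src r) c.dir t)
      rwa [Finset.sum_const, Finset.card_range, nsmul_eq_mul] at this
    refine (Finset.sum_le_sum fun r _ => hin r).trans ?_
    rw [Finset.sum_const, Finset.card_univ, Fintype.card_fun, Fintype.card_fin, Fintype.card_fin, nsmul_eq_mul, Nat.cast_pow, pow_succ]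
    ring_nf; rfl
  calc ((P.L : ℝ) ^ (P.d + 1))⁻¹ * ‖_‖ ≤ ((P.L : ℝ) ^ (P.d + 1))⁻¹ * ((P.L : ℝ) ^ (P.d + 1) * a) := mul_le_mul_of_nonneg_left hsum hL0
    _ = a := by field_simp

omit [Nonempty n] in
/-- **The straight-line mean**: `‖Q₁A(c) + (λ̄_A(c₊) − λ̄_A(c₋))‖ = ‖L·(QA)(c)‖ ≤ L·a` (`linAvg_eq_bondAvg_sub_grad_combMean`). [cite: Balaban1985Averaging, (124)-(125) p.36 and (62) p.28] -/
theorem norm_linAvg_add_combGrad_le (A : PBond P j → Matrix n n ℂ) {a : ℝ} (hA : ∀ b, ‖A b‖ ≤ a) (c : PBond P (j + 1)) :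
    ‖linAvg A c + (combMean A c.tgt - combMean A c.src)‖ ≤ (P.L : ℝ) * a := by
  rw [linAvg_eq_bondAvg_sub_grad_combMean, sub_add_cancel, norm_smul, Complex.norm_natCast]
  exact mul_le_mul_of_nonneg_left (norm_bondAvg_le_of_bound A hA c) (Nat.cast_nonneg _)

omit [Nonempty n] in
/-- **The comb generator is small**: `‖λ̄_A(y)‖ ≤ ℓ·a` (`ℓ = (d+2)L`; UST `norm_combMean_le`). [cite: Balaban1985Averaging, (62) p.28] -/
theorem norm_combMean_le_of_bound (A : PBond P j → Matrix n n ℂ) {a : ℝ} (ha : 0 ≤ a) (hA : ∀ b, ‖A b‖ ≤ a) (y : Site P (j + 1)) :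
    ‖combMean A y‖ ≤ (((P.d + 2) * P.L : ℕ) : ℝ) * a :=
  norm_combMean_le A ha hA y

/-- ★★★ **THE C⁰ COMB LETTER IN THE NEAR-IDENTITY GAUGE**: for `S = (exp iηA)·U₀` with `|A| ≤ a`, `‖U₀ − 1‖ ≤ t` on all bonds, `ηa ≤ 1∕2`,
`136ℓ(s + t) ≤ 1` (`s = 2ηa + t + 2ηa·t`), `ξ > 0`:
`‖(iξ)⁻¹ log(Ū(S)(c)Ū(U₀)(c)⁻¹) + (η∕ξ)(λ̄_A(c₊) − λ̄_A(c₋))‖ ≤ (η∕ξ)·L·a + R∕ξ` with (9a)'s second-order `R` — i.e. after the (linearised) comb gauge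
transformation generated by `η·λ̄_A` the new potential is the straight-line mean of `A` (coefficient `ηL∕ξ`, `= 1` at `ξ = Lη`) up to second order: the
`α₁`-radius is transported with leading coefficient ONE, not the trivial comb's `176(d+2)` (FILE G′ p622641).
[cite: Balaban1985Averaging, Prop. 3 (62)-(63) p.28, (122)-(126) p.36; Balaban1987RG1, (0.4) p.253, (1.13) p.262] -/
theorem norm_potential_add_combGrad_le (hj : j + 1 ≤ P.m + P.K) {U₀ S : GaugeField P j (Matrix n n ℂ)ˣ} {A : PBond P j → Matrix n n ℂ} {η ξ a t : ℝ}
    (hη : 0 ≤ η) (hξ : 0 < ξ) (hS : ∀ b, S b = expI η (A b) * U₀ b) (ha0 : 0 ≤ a) (hA : ∀ b, ‖A b‖ ≤ a) (hηa : η * a ≤ 1 / 2) (ht0 : 0 ≤ t)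
    (hU : ∀ b, ‖((U₀ b : (Matrix n n ℂ)ˣ) : Matrix n n ℂ) - 1‖ ≤ t)
    (hℓ : 136 * (((P.d + 2) * P.L : ℕ) : ℝ) * ((2 * (η * a) + t + 2 * (η * a) * t) + t) ≤ 1) (c : PBond P (j + 1)) :
    ‖(I * (ξ : ℂ))⁻¹ • mlog (((avgUnits S c : (Matrix n n ℂ)ˣ) : Matrix n n ℂ) * (((avgUnits U₀ c)⁻¹ : (Matrix n n ℂ)ˣ) : Matrix n n ℂ)) +
        ((η / ξ : ℝ) : ℂ) • (combMean A c.tgt - combMean A c.src)‖ ≤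
      η / ξ * ((P.L : ℝ) * a) +
      (4 * (34 * (((P.d + 2) * P.L : ℕ) : ℝ) * ((2 * (η * a) + t + 2 * (η * a) * t) + t)) ^ 2 +
        578 * (((P.d + 2) * P.L : ℕ) : ℝ) ^ 2 * ((2 * (η * a) + t + 2 * (η * a) * t) + t) * t +
        660 * (((P.d + 2) * P.L : ℕ) : ℝ) ^ 2 * ((2 * (η * a) + t + 2 * (η * a) * t) ^ 2 + t ^ 2) +
        3 * (((P.d + 2) * P.L : ℕ) : ℝ) * (2 * (η * a) * t) + 3 * (((P.d + 2) * P.L : ℕ) : ℝ) * (η * a) ^ 2) / ξ := by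
  have h1 := norm_potential_sub_linAvg_le hj hη hξ hS ha0 hA hηa ht0 hU hℓ c
  have h2 := norm_linAvg_add_combGrad_le A hA c
  set H := (I * (ξ : ℂ))⁻¹ • mlog (((avgUnits S c : (Matrix n n ℂ)ˣ) : Matrix n n ℂ) * (((avgUnits U₀ c)⁻¹ : (Matrix n n ℂ)ˣ) : Matrix n n ℂ)) with hH
  have hsplit : H + ((η / ξ : ℝ) : ℂ) • (combMean A c.tgt - combMean A c.src) =
      (H - ((η / ξ : ℝ) : ℂ) • linAvg A c) + ((η / ξ : ℝ) : ℂ) • (linAvg A c + (combMean A c.tgt - combMean A c.src)) := by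
    rw [smul_add]; abel
  rw [hsplit]
  refine (norm_add_le _ _).trans ?_
  have h3 : ‖((η / ξ : ℝ) : ℂ) • (linAvg A c + (combMean A c.tgt - combMean A c.src))‖ ≤ η / ξ * ((P.L : ℝ) * a) := by
    rw [norm_smul, Complex.norm_real, Real.norm_of_nonneg (div_nonneg hη hξ.le)]
    exact mul_le_mul_of_nonneg_left h2 (div_nonneg hη hξ.le)
  linarith

end YMDAG.N18.TransportOfRecord

end
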